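import Summits.BirchSwinnertonDyer.Rank1Residual.X2.NonPrimitiveLambdaLeGoodOrdinary
import Summits.BirchSwinnertonDyer.Rank1Residual.X2.GreenbergVatsalAnalyticTransferLe
import Summits.BirchSwinnertonDyer.Rank1Residual.X2.GreenbergVatsalCaseOneLe
import Summits.BirchSwinnertonDyer.Rank1Residual.X2.GreenbergVatsalThm13GoodOrdinaryTateFree
import HarnessLib

/-!
# GV Thm. (1.3), CASE 1 at an odd GOOD ORDINARY Eisenstein prime, UPPER HALF, WITHOUT the datum
# record (A115 / T-GV23L) — cell `b2b-bsdres`, unit `b2b-bsdres-eisenstein-p2`, gen 30 (F8b)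

HONEST FRAMING (run/shared/lean/b2b/bsd-rank1-residual/, verbatim in every file): the goal of the
cell is to DELETE the COMBINATION-SHAPED residual classes of the Birch–Swinnerton-Dyer formula for
ALL analytic-rank `≤ 1` elliptic curves over `ℚ` — "full BSD formula for every rank `≤ 1` curve in
class `C`" assembled STRICTLY from published theorems — so that the rank-`≤ 1` remainder becomes
exactly the CONSTRUCTION-SHAPED classes, which are TYPED (missing-input `Prop`s), NOT attempted.
This is not "finishing BSD". Research route; NO CLAIM BEYOND STATED CLASSES; nothing here changes a
label. Theorems only; no definition, no named fact, no `sorry`.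

WHAT. The good-ordinary twin of gen 30's `GreenbergVatsalAnalyticTransferLe` /
`GreenbergVatsalCaseOneLe`: the A14 chain (`GreenbergVatsalThm13{GoodOrdinaryTateFree,PeriodFree}`)
consumes A115 (`λ(Sel^{Σ₀}) = λ(Sel) + Σδ`, or the datum record T-GV23L) only through the count
EQUALITY of GV (16); its upper half is the kernel theorem
`NonPrimitiveLambdaLeGoodOrdinary.natCard_line_mul_quotSelmer_le_of_goodOrd` (F8a; inputs `hGV`,
A40/A41 at the multiplicative places of `Σ₀`, A116), and its lower half is Wuthrich Thm. 16 (`hW16`,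
already a binder of the A14 term). This file: the clause's upper half in CASE 1,

* `unitContent_and_order_le_of_card_eq_of_goodOrd` — `HasUnitContent b ∧ ord_T(b̄) ≤ ord_T(f̄_E)`;
* **`caseOne_clause_goodOrdHalf_le`** — CASE 1 (line ramified at `p`, even) for every `b` with
  `ι b = ϖ·L(E/ℚ,T)`, binders {`hGV`, `hT`, `hT'`, `hB` (A116), `hG'` (good-ordinary half of Prop.
  5.10), `hLiftF` (A195), `hAn`}.

The sequel `GreenbergVatsalThm13DatumFree` does CASE 2 and the assembly of A14.

References: [GreenbergVatsal2000] Thm. (1.3), §2 (16), pp. 26–30, §3 Thm. (3.11), (28), p. 43;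
[GreenbergLNM1716] Prop. 5.10; HOME/b2b-bsdres-eisenstein-p2/X2-GAP.md §35.
-/

set_option autoImplicit false

noncomputable section

open scoped Classical AddSubgroup MatrixGroups ModularForm

open PowerSeries NumberField IsDedekindDomain Field WeierstrassCurve CongruenceSubgroup
  Literature.NumberTheory.EllipticCurves Literature.NumberTheory.EllipticCurves.GreenbergVatsal2000
  Literature.NumberTheory.EllipticCurves.ModularForms
  Literature.NumberTheory.EllipticCurves.Rank1Residual
  Summit.BirchSwinnertonDyer.Rank1Residual.X2.EulerFactorAlgebra
  Summit.BirchSwinnertonDyer.Rank1Residual.X2.EulerFactorInvariants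
  Summit.BirchSwinnertonDyer.Rank1Residual.X2.GreenbergVatsalAnalyticTransferCore
  Summit.BirchSwinnertonDyer.Rank1Residual.X2.ResidualDevissageGoodOrdinary
  Summit.BirchSwinnertonDyer.Rank1Residual.X2.GreenbergVatsalCaseOneGoodOrdinary

namespace Summit.BirchSwinnertonDyer.Rank1Residual.X2.GreenbergVatsalCaseOneGoodOrdinaryLe

/-! ## §1. (A)+(C)+(D) at a good ordinary prime (`e = 0`), upper half -/

section Assembly

variable (W : WeierstrassCurve ℚ) [W.IsGloballyMinimal] [W.IsElliptic] (p : ℕ) [hp : Fact p.Prime]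
  (κ : ZpExtension ℚ p) {γ : absoluteGaloisGroup ℚ} (S₀ : Finset (HeightOneSpectrum (𝓞 ℚ)))
  {Φ₀ : AddSubgroup (W.geomTorsion (p : ℤ))} (hΦ : IsRationalLine W p Φ₀)

/-- **GOOD ORDINARY odd `p`, GV case 1 — the `λ`/`μ^{anal}` clause, UPPER HALF, from ONE displayed
analytic hypothesis and NO datum record.** Inputs: `hGV` (p221999), A40/A41 (`hT`, `hT'`), A116
(`hB`); `κ` cyclotomic with topological generator `γ`; `Σ₀ ∌ p` finite, BAD, containing every bad
place; `D` f.g. torsion with `μ(X) = 0`; the line `Φ₀` ramified at `p` and even; the lifting property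
`hlift`; the analytic statement (C) for `b·∏_{ℓ∈Σ₀}𝒫_ℓ`. Output: `b` has unit content and
`ord_T(b mod p) ≤ ord_T(f_E mod p)` — gen 19's `unitContent_and_order_eq_of_card_eq_of_goodOrd` with
the count EQUALITY (A115) replaced by the kernel INEQUALITY
(`NonPrimitiveLambdaLeGoodOrdinary.natCard_line_mul_quotSelmer_le_of_goodOrd`).
[cite: GreenbergVatsal2000, §2 (16) pp. 28–30 and §3 p. 43] -/
theorem unitContent_and_order_le_of_card_eq_of_goodOrd
    (hGV : imKummer_ge_greenbergCondition_at_p)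
    (hT : Silverman1994_thmV53_tateUniformisation.{0})
    (hT' : Silverman1994_thmV53_corV54_tateUniformisation.{0})
    (hB : divisible_nonPrimitiveSelmerInfty_of_mu_eq_zero)
    (hκ : κ.IsCyclotomic) (hγ : κ.IsTopGenerator γ) (hp2 : p ≠ 2)
    (hgood : W.HasGoodReductionAtPrime p) (hord : ¬ (p : ℤ) ∣ W.frobeniusTrace p)
    (hS₀ : ∀ v ∈ S₀, ((p : ℕ) : 𝓞 ℚ) ∉ v.asIdeal) (hbad : ∀ v ∈ S₀, ¬ W.HasGoodReductionAt v)
    (hS : ∀ v : HeightOneSpectrum (𝓞 ℚ), v ∉ S₀ → ((p : ℕ) : 𝓞 ℚ) ∉ v.asIdeal →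
      W.HasGoodReductionAt v)
    (D : W.SelmerDualData κ γ) [Module.Finite (IwasawaAlgebra p) D.X] (hX : D.IsTorsion)
    (hμ : D.mu = 0) (hram : ¬ LineUnramifiedAt W p Φ₀) (heven : LineEven W p Φ₀)
    (hlift : ∀ s ∈ ResidualDevissageSelmer.quotSelmer κ.kerSubgroup
        (ResidualDevissageLine.lineSub Φ₀ hΦ).Quot p (↑S₀ : Set (HeightOneSpectrum (𝓞 ℚ))),
      ∃ x ∈ GreenbergVatsal2000.unramifiedOutside κ.kerSubgroup
          ↥((↥(W.geomPrimaryTorsion p))[(p : ℤ)]) p (↑S₀ : Set (HeightOneSpectrum (𝓞 ℚ))),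
        ResidualDevissageSelmer.subH1 κ.kerSubgroup (ResidualDevissageLine.lineSub Φ₀ hΦ).proj
          (ResidualDevissageLine.lineSub Φ₀ hΦ).proj_smul x = s)
    {b : IwasawaAlgebra p}
    (hC : HasUnitContent (b * eulerFactorProduct W p S₀) ∧
      p ^ (PowerSeries.map (PadicInt.toZMod (p := p)) (b * eulerFactorProduct W p S₀)).order.toNat =
        Nat.card (GreenbergVatsal2000.unramifiedOutside κ.kerSubgroup
            (ResidualDevissageLine.lineSub Φ₀ hΦ).Sub p (↑S₀ : Set (HeightOneSpectrum (𝓞 ℚ)))) *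
          Nat.card (ResidualDevissageSelmer.quotSelmer κ.kerSubgroup
            (ResidualDevissageLine.lineSub Φ₀ hΦ).Quot p (↑S₀ : Set (HeightOneSpectrum (𝓞 ℚ)))))
    {fE : IwasawaAlgebra p} (hchar : D.charIdeal = Ideal.span {fE}) :
    HasUnitContent b ∧
      (PowerSeries.map (PadicInt.toZMod (p := p)) b).order ≤
        (PowerSeries.map (PadicInt.toZMod (p := p)) fE).order := by
  have hS₀' : ∀ v ∈ S₀, Rat.HeightOneSpectrum.natGenerator v ≠ p :=
    fun v hv => natGenerator_ne_of_natCast_not_mem v (hS₀ v hv)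
  have hΔ : ¬ (p : ℤ) ∣ minimalDiscriminantInt W :=
    W.not_dvd_minimalDiscriminantInt_of_hasGoodReductionAtPrime' p hgood
  obtain ⟨hbu, hC⟩ := hC
  have hA' := NonPrimitiveLambdaLeGoodOrdinary.natCard_line_mul_quotSelmer_le_of_goodOrd W p κ S₀ hΦ
    hGV hT hT' hB hκ hγ hp2 hgood hord hΔ hS₀ hbad hS D hX hμ hram heven hlift
  rw [← hC] at hA'
  have hexp : (PowerSeries.map (PadicInt.toZMod (p := p)) (b * eulerFactorProduct W p S₀)).order.toNat ≤
      lambdaInvariant p D.X + ∑ v ∈ S₀, delta W p v + 0 := by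
    rw [add_zero]; exact (pow_le_pow_iff_right₀ hp.out.one_lt).1 hA'
  have h := GreenbergVatsalAnalyticTransferLe.unitContent_and_order_le_of_order_nonPrimitive_le W S₀
    hp2 hS₀' D hX hμ hchar 0 hbu hexp
  rwa [Nat.cast_zero, add_zero] at h

end Assembly

/-! ## §2. CASE 1 of GV Thm. (1.3) at a good ordinary prime, upper half -/

/-- **GV Thm. (1.3), CASE 1 (rational line RAMIFIED at `p` and EVEN), at a GOOD ORDINARY prime,
UPPER HALF, NO datum record**: every `b ∈ Λ` with `ι b = ϖ · L(E/ℚ,T)` has unit content and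
`ord_T(b mod p) ≤ ord_T(f_E mod p)`. Gen 24's `caseOne_clause_goodOrdHalf` with A115 (`hA`) replaced
by A40/A41 (`hT`, `hT'`) and `Σ₀ :=` the BAD places `∤ p` (`exists_finset_bad_not_mem_bad`); the
lower half is Wuthrich Thm. 16 at the assembly (`GreenbergVatsalThm13DatumFree`).
[cite: GreenbergVatsal2000, Thm. (1.3) (proof, p. 43) with §2 (16)] [cite: GreenbergLNM1716, Prop. 5.10 (PDF p. 147)] -/
theorem caseOne_clause_goodOrdHalf_le
    (hGV : imKummer_ge_greenbergCondition_at_p)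
    (hT : Silverman1994_thmV53_tateUniformisation.{0})
    (hT' : Silverman1994_thmV53_corV54_tateUniformisation.{0})
    (hB : divisible_nonPrimitiveSelmerInfty_of_mu_eq_zero)
    (hG' : ∀ (W : WeierstrassCurve ℚ) [W.IsElliptic] [W.IsGloballyMinimal] (p : ℕ) [Fact p.Prime]
      {κ : ZpExtension ℚ p} {γ : absoluteGaloisGroup ℚ},
      p ≠ 2 → W.HasGoodReductionAtPrime p → ¬ (p : ℤ) ∣ W.frobeniusTrace p → GVPar W p →
      κ.IsCyclotomic → κ.IsTopGenerator γ → ∀ D : W.SelmerDualData κ γ,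
      D.IsTorsion ∧ ∃ g : IwasawaAlgebra p, D.charIdeal = Ideal.span {g} ∧ HasUnitContent g)
    (hLiftF : residualEpsilon_surjOn_of_lineRamifiedEven)
    (hAn : ∀ (W : WeierstrassCurve ℚ) [W.IsGloballyMinimal] [W.IsElliptic] (p : ℕ) [Fact p.Prime]
      (κ : ZpExtension ℚ p) {N : ℕ} [NeZero N] (f : CuspForm (Gamma0 N) 2)
      (S₀ : Finset (HeightOneSpectrum (𝓞 ℚ)))
      (Φ₀ : AddSubgroup (W.geomTorsion (p : ℤ))) (hΦ : IsRationalLine W p Φ₀),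
      p ≠ 2 → W.HasGoodReductionAtPrime p → ¬ (p : ℤ) ∣ W.frobeniusTrace p → κ.IsCyclotomic →
      ¬ LineUnramifiedAt W p Φ₀ → LineEven W p Φ₀ → IsNewformOf W f →
      (∀ v ∈ S₀, ((p : ℕ) : 𝓞 ℚ) ∉ v.asIdeal) →
      (∀ v : HeightOneSpectrum (𝓞 ℚ), v ∉ S₀ → ((p : ℕ) : 𝓞 ℚ) ∉ v.asIdeal →
        W.HasGoodReductionAt v) →
      ∀ (ϖ : ℚ), (ϖ : ℝ) * W.realPeriodRat = plusPeriod f →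
      ∀ (b : IwasawaAlgebra p),
        iwasawaToPowerSeries p b =
          PowerSeries.C ((ϖ : ℚ) : ℚ_[p]) * padicLFunction f (unitRoot W p : ℚ_[p]) →
        HasUnitContent (b * eulerFactorProduct W p S₀) ∧
          p ^ (PowerSeries.map (PadicInt.toZMod (p := p)) (b * eulerFactorProduct W p S₀)).order.toNat =
            Nat.card (residualLineH1 W p κ S₀ Φ₀ hΦ) * Nat.card (residualQuotSelmer W p κ S₀ Φ₀ hΦ))
    (W : WeierstrassCurve ℚ) [W.IsElliptic] [W.IsGloballyMinimal] (p : ℕ) [Fact p.Prime]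
    {κ : ZpExtension ℚ p} {γ : absoluteGaloisGroup ℚ} {N : ℕ} [NeZero N]
    {f : CuspForm (Gamma0 N) 2}
    (hp : p ≠ 2) (hgood : W.HasGoodReductionAtPrime p) (hord : ¬ (p : ℤ) ∣ W.frobeniusTrace p)
    {Φ₀ : AddSubgroup (W.geomTorsion (p : ℤ))} (hΦ : IsRationalLine W p Φ₀)
    (hram : ¬ LineUnramifiedAt W p Φ₀) (heven : LineEven W p Φ₀)
    (hκ : κ.IsCyclotomic) (hγ : κ.IsTopGenerator γ) (hf : IsNewformOf W f)
    (D : W.SelmerDualData κ γ) (ϖ : ℚ) (hϖ : (ϖ : ℝ) * W.realPeriodRat = plusPeriod f)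
    (fE : IwasawaAlgebra p) (hchar : D.charIdeal = Ideal.span {fE}) :
    ∀ (b : IwasawaAlgebra p),
      iwasawaToPowerSeries p b =
        PowerSeries.C ((ϖ : ℚ) : ℚ_[p]) * padicLFunction f (unitRoot W p : ℚ_[p]) →
      HasUnitContent b ∧
        (PowerSeries.map (PadicInt.toZMod (p := p)) b).order ≤
          (PowerSeries.map (PadicInt.toZMod (p := p)) fE).order := by
  intro b hb
  -- the cell's standing data: bad Σ₀, finiteness, torsion, μ = 0
  obtain ⟨S₀, hS₀, hbad, hS⟩ := GreenbergVatsalCaseOneLe.exists_finset_bad_not_mem_bad W p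
  haveI : Module.Finite (IwasawaAlgebra p) D.X :=
    WeierstrassCurve.SelmerDualData.module_finite_of_isCyclotomic W κ hκ D hγ
  have hpar : GVPar W p := ⟨Φ₀, hΦ, Or.inl ⟨hram, heven⟩⟩
  obtain ⟨hX, g, hcharg, hug⟩ := hG' W p hp hgood hord hpar hκ hγ D
  have hμ : D.mu = 0 := (mu_eq_zero_iff_hasUnitContent D hX hcharg).mpr hug
  -- the lifting (GV p. 28/30) and the analytic statement (GV §3), definitionally in gen 16's terms
  have hC := hAn W p κ f S₀ Φ₀ hΦ hp hgood hord hκ hram heven hf hS₀ hS ϖ hϖ b hb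
  exact unitContent_and_order_le_of_card_eq_of_goodOrd W p κ S₀ hΦ hGV hT hT' hB hκ hγ hp hgood hord
    hS₀ hbad hS D hX hμ hram heven (hLiftF W p κ S₀ Φ₀ hΦ hp hκ hram heven hS₀ hS) hC hchar

end Summit.BirchSwinnertonDyer.Rank1Residual.X2.GreenbergVatsalCaseOneGoodOrdinaryLe

end
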